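import Summits.KontsevichZagierPeriods.Zeta5Search.PolyReflect
import HarnessLib

/-!
# Symmetric-ray certificate data `t2Data`, rows `t^38 … t^43` (cell `pub-zeta5`, P1)

HONEST FRAMING: systematic search; no irrationality claim unless certified.
The expanded product `T2 = P2(n)·N2(n,t)·B(n,t)` (telescoper coefficient × shift numerator × Gosper denominator) of the symmetric-ray certificate identity; each piece is certified against the product by `decide` in `SymRayGosper.lean`.
-/

namespace Summit.KontsevichZagierPeriods.Zeta5Search.SymRay

open Summit.KontsevichZagierPeriods.Zeta5Search.PolyReflect

/-- Rows `t^38 … t^43` of `t2Data` (coefficient lists in `n`, constant term first). -/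
def t2DataC : Poly2 :=
  [
    [-260186733373403418624, -3264377792075764055808, -19398139908001710632192, -72639485122225716277760, 
     -192381444054306347221984, -383369507849374957741808, -597016838640741738034112, -744843933185636023754440, 
     -757139185397327177727806, -634293595535005467490328, -441214975339419932684092, -255923474338697318172308, 
     -123969325429619625842204, -50089947766966729814044, -16814974994468302996820, -4656296913792968308964, 
     -1051817651895478478986, -190633972073983108196, -27048863184009728648, -2893718880011410096, 
     -219458416607524476, -10515338468120712, -239313073964520],
    [-7409658734874859008, -90062380218627880192, -517182706292351128192, -1866404261832513349568, 
     -4749359381149993275808, -9063178129217313306544, -13465760867064933405848, -15962042792991676887172, 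
     -15344150886535632406912, -12091561763624300106608, -7863133066049760130792, -4233425510743073496160, 
     -1887304668506867461832, -694668504660338371504, -209773288398058759408, -51429184243956422276, 
     -10074001533915982696, -1539066557716662112, -176691374996086160, -14336748333717528, -732950303427120, 
     -17753836724112],
    [-163195212629041152, -1920303565110637760, -10646411711629652448, -36982197758361264032, -90282782638204468048, 
     -164673834312397509468, -232887348273774966230, -261539415752452724908, -236920450456130254014, 
     -174854455790500977752, -105730915978775867362, -52482386099029839540, -21351353228818239038, 
     -7081794585648686860, -1896614741225724744, -403898521017570584, -66802762966676500, -8271548194419768, 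
     -721430591235728, -39525223839920, -1023191345328],
    [-2608327621501056, -29689763117820480, -158756237109859520, -530123683542732704, -1239499284615848680, 
     -2156382635258630804, -2895168826790361560, -3070233368898740008, -2610159221922117584, -1794930481444498808, 
     -1002721016267771248, -455136608445685880, -167193670455723752, -49281036489346444, -11487426707877032, 
     -2069729133615920, -277993691058880, -26201978021384, -1546102838384, -42975865264],
    [-26913559526400, -296099977354816, -1525363244577184, -4889333870109920, -10928696978308720, -18091658258846740, 
     -22990465073039234, -22935040819641316, -18210941243442838, -11597267448539000, -5938496495688010, 
     -2439741747352468, -798368314691462, -205309191690292, -40586790508060, -5952613513040, -610050266020, 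
     -38993096920, -1170096584],
    [-134567797632, -1429700543168, -7087104267840, -21771287489440, -46424823864280, -72932920285468, 
     -87420147957432, -81674098244276, -60222734130000, -35252255108620, -16384756174936, -6013463280724, 
     -1721759184984, -376581866120, -60774298080, -6820770040, -475410640, -15497968] ]

end Summit.KontsevichZagierPeriods.Zeta5Search.SymRay
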